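import Summits.CriticalPhenomena.PercolationContinuityZ3.Theorems.PercNearOneGluingNoHeavyLowerTailSahiPair43LinkTables

/-!
# `NoHeavyLowerTail` (crux stmt-CriticalPhenomena-4575), Sahi programme: the cell `(4,3)` — **link, node preliminaries**: codes, the node of
# a finset of points, its signature, the colouring code, the chain-count bound

Support file (Sahi cell `prim-sahi`, seat `prim-sahi-typer` gen 32; `--supports stmt-CriticalPhenomena-4575`).  Pure proofs plus
bookkeeping functions (`codes`, `nodeList`, `sigP`, `colourCode`, `clsA`); no `sorry`, standard axioms.

* `not_mem_iff_exists_coGen`: an up-set is the complement of the down-set of its co-generators; `pairCond_disjoint`, `pairCond_incomp`: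
  for a `PairCond` pair, `N = coGen A ∪ coGen B` is a disjoint union and an antichain;
* `codes`, `nodeList` (the increasing code list of a finset of points), `adm_nodeList` (the node of `N` is admissible for the walk),
  `sigAdd_nodeList` (the accumulated signature is `sigP a N = Σ_{q∈N} sw a (enc q)`), `sw_enc`;
* `colourCode` (bit `j` iff the `(j+1)`-st code is in the first class), `cls_colourCode`;
* `testBit_free`, **`card_le_chainCount`**: a free antichain has at most `chainCount free` points (pigeonhole over `chainIdT`). [this work]
-/

namespace Summit.CriticalPhenomena.PercolationContinuityZ3.Theorems.SahiGridPattern.Pair43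

open Finset SahiGrid3 SahiGridPattern
open scoped BigOperators

/-! ### Up-sets and their co-generators -/

/-- **An up-set is the complement of the down-set of its co-generators.** [this work] -/
theorem not_mem_iff_exists_coGen {A : Finset (Pd 4)} (hA : IsUpperSet (A : Set (Pd 4))) (p : Pd 4) :
    p ∉ A ↔ ∃ x ∈ coGen A, p ≤ x := by
  classical
  constructor
  · intro hp
    obtain ⟨m, hm, hmax⟩ := Finset.exists_max_image (univ.filter fun y : Pd 4 => p ≤ y ∧ y ∉ A)
      (fun y : Pd 4 => ∑ a, (y a : ℕ)) ⟨p, by simp only [mem_filter, mem_univ, true_and]; exact ⟨le_refl p, hp⟩⟩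
    simp only [mem_filter, mem_univ, true_and] at hm hmax
    refine ⟨m, mem_coGen.2 ⟨hm.2, fun y hy => ?_⟩, hm.1⟩
    by_contra hyA
    have h1 := hmax y ⟨le_trans hm.1 (le_of_lt hy), hyA⟩
    have h2 : ∑ a, (m a : ℕ) < ∑ a, (y a : ℕ) := by
      obtain ⟨hle, a, ha⟩ := Pi.lt_def.1 hy
      exact Finset.sum_lt_sum (fun b _ => by exact_mod_cast hle b) ⟨a, mem_univ _, by exact_mod_cast ha⟩
    omega
  · rintro ⟨x, hx, hpx⟩ hp
    exact (mem_coGen.1 hx).1 (hA hpx hp)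

/-- An up-set without co-generators is everything. [this work] -/
theorem eq_univ_of_coGen_eq_empty {A : Finset (Pd 4)} (hA : IsUpperSet (A : Set (Pd 4))) (h : coGen A = ∅) : A = univ := by
  ext p
  simp only [mem_univ, iff_true]
  by_contra hp
  obtain ⟨x, hx, _⟩ := (not_mem_iff_exists_coGen hA p).1 hp
  rw [h] at hx
  exact absurd hx (Finset.notMem_empty x)

/-- The two co-generator sets of a `PairCond` pair are disjoint. [this work] -/
theorem pairCond_disjoint {A B : Finset (Pd 4)} (h : PairCond A B) : Disjoint (coGen A) (coGen B) := by
  rw [Finset.disjoint_left]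
  intro x hxA hxB
  exact (mem_coGen.1 hxB).1 (h.genA hxA)

/-- `N = coGen A ∪ coGen B` is an antichain: distinct elements are incomparable. [this work] -/
theorem pairCond_incomp {A B : Finset (Pd 4)} (h : PairCond A B) {x y : Pd 4} (hx : x ∈ coGen A ∪ coGen B)
    (hy : y ∈ coGen A ∪ coGen B) (hne : x ≠ y) : ¬ x ≤ y := by
  intro hle
  have hlt : x < y := lt_of_le_of_ne hle hne
  rcases mem_union.1 hx with hx | hx <;> rcases mem_union.1 hy with hy | hy
  · exact (mem_coGen.1 hy).1 ((mem_coGen.1 hx).2 y hlt)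
  · exact (mem_coGen.1 hy).1 (h.upB hle (h.genA hx))
  · exact (mem_coGen.1 hy).1 (h.upA hle (h.genB hx))
  · exact (mem_coGen.1 hy).1 ((mem_coGen.1 hx).2 y hlt)

/-! ### Codes and the node of a finset of points -/

/-- The set of codes of a finset of points. [this work] -/
def codes (S : Finset (Pd 4)) : Finset ℕ := S.image enc

/-- Membership in `codes`. [this work] -/
theorem mem_codes {S : Finset (Pd 4)} {k : ℕ} : k ∈ codes S ↔ ∃ p ∈ S, enc p = k := by
  unfold codes; rw [mem_image]

/-- The code of `p` is a code of `S` iff `p ∈ S`. [this work] -/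
theorem enc_mem_codes {S : Finset (Pd 4)} {p : Pd 4} : enc p ∈ codes S ↔ p ∈ S := by
  rw [mem_codes]
  exact ⟨fun ⟨q, hq, e⟩ => enc_injective e ▸ hq, fun h => ⟨p, h, rfl⟩⟩

/-- `codes` preserves cardinality. [this work] -/
theorem card_codes (S : Finset (Pd 4)) : (codes S).card = S.card := card_image_of_injective _ enc_injective

/-- Codes are `< 81`. [this work] -/
theorem lt_of_mem_codes {S : Finset (Pd 4)} {k : ℕ} (h : k ∈ codes S) : k < 81 := by
  obtain ⟨p, _, rfl⟩ := mem_codes.1 h; exact enc_lt p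

/-- The node of a finset of points: its codes in increasing order. [this work] -/
def nodeList (S : Finset (Pd 4)) : List ℕ := (codes S).sort

/-- Membership in the node. [this work] -/
theorem mem_nodeList {S : Finset (Pd 4)} {k : ℕ} : k ∈ nodeList S ↔ k ∈ codes S := by
  unfold nodeList; rw [Finset.mem_sort]

/-- The node has no duplicates. [this work] -/
theorem nodeList_nodup (S : Finset (Pd 4)) : (nodeList S).Nodup := Finset.sort_nodup _ _

/-- The node lists `|S|` codes. [this work] -/
theorem length_nodeList (S : Finset (Pd 4)) : (nodeList S).length = S.card := by
  unfold nodeList; rw [Finset.length_sort, card_codes]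

/-- The node as a finset. [this work] -/
theorem nodeList_toFinset (S : Finset (Pd 4)) : (nodeList S).toFinset = codes S := Finset.sort_toFinset _ _

/-- The node is strictly increasing. [this work] -/
theorem nodeList_pairwise_lt (S : Finset (Pd 4)) : (nodeList S).Pairwise (· < ·) := (Finset.sortedLT_sort _).pairwise

/-- Entries of the node are codes of `S`. [this work] -/
theorem getD_nodeList_mem {S : Finset (Pd 4)} {i : ℕ} (hi : i < (nodeList S).length) : (nodeList S).getD i 0 ∈ codes S := by
  rw [← mem_nodeList, List.getD_eq_getElem _ _ hi]; exact List.getElem_mem hi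

/-! ### `pushList`, `sigAdd`, admissibility of the node -/

/-- `pushList` appends. [this work] -/
theorem toList_pushList : ∀ (pts : Array ℕ) (l : List ℕ), (pushList pts l).toList = pts.toList ++ l
  | pts, [] => by simp [pushList]
  | pts, x :: l => by rw [pushList, toList_pushList, Array.toList_push, List.append_assoc]; rfl

/-- `pushList #[] l` is `l` as an array. [this work] -/
theorem pushList_nil (l : List ℕ) : pushList #[] l = l.toArray := by
  apply Array.ext'; rw [toList_pushList]; simp

/-- `sigAdd` is a sum. [this work] -/
theorem sigAdd_eq : ∀ (s a : ℕ) (l : List ℕ), sigAdd s a l = s + (l.map (sw a)).sum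
  | s, a, [] => by simp [sigAdd]
  | s, a, x :: l => by rw [sigAdd, sigAdd_eq]; simp [add_assoc]

/-- Admissibility from membership and pairwise compatibility. [this work] -/
theorem adm_of_pairwise : ∀ {c : ℕ} {l : List ℕ}, (∀ y ∈ l, c.testBit y = true) →
    l.Pairwise (fun x y => (nextT.getD x 0).testBit y = true) → Adm c l
  | _, [], _, _ => trivial
  | c, x :: l, hc, hp => by
    rw [List.pairwise_cons] at hp
    refine ⟨hc x List.mem_cons_self, adm_of_pairwise (fun y hy => ?_) hp.2⟩
    rw [Nat.testBit_and, hc y (List.mem_cons_of_mem x hy), hp.1 y hy, Bool.and_self]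

/-- **The node of the antichain `N = coGen A ∪ coGen B` is admissible from `FULL`.** [this work] -/
theorem adm_nodeList {A B : Finset (Pd 4)} (h : PairCond A B) : Adm FULL (nodeList (coGen A ∪ coGen B)) := by
  apply adm_of_pairwise
  · intro y hy
    rw [testBit_FULL]; exact decide_eq_true (lt_of_mem_codes (mem_nodeList.1 hy))
  · refine (nodeList_pairwise_lt _).imp_of_mem fun {x y} hx hy hxy => ?_
    obtain ⟨p, hp, rfl⟩ := mem_codes.1 (mem_nodeList.1 hx)
    obtain ⟨q, hq, rfl⟩ := mem_codes.1 (mem_nodeList.1 hy)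
    have hne : p ≠ q := fun e => by subst e; exact lt_irrefl _ hxy
    rw [testBit_nextT (enc_lt p), (leC_enc_eq_false p q).2 (pairCond_incomp h hp hq hne), (leC_enc_eq_false q p).2 (pairCond_incomp h hq hp hne.symm)]
    simp [enc_lt q, hxy]

/-! ### Signatures -/

/-- The axis-`a` signature of a finset of points: `Σ_{q∈S} sw a (enc q)` (`= Σ wv(q_a)·hs(q)`, `sw_enc`). [this work] -/
def sigP (a : ℕ) (S : Finset (Pd 4)) : ℕ := ∑ q ∈ S, sw a (enc q)

/-- The signature-weight table at a code. [this work] -/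
theorem sw_enc (a : Fin 4) (q : Pd 4) : sw a (enc q) = wv (q a) * hs (enc q) := by
  unfold sw sigW
  rw [SahiSlot34.getD_ofFn _ _ a.isLt, SahiSlot34.getD_ofFn _ _ (enc_lt q)]
  show wv (dg (enc q) a) * hs (enc q) = _
  rw [dg_enc]

/-- **The accumulated signature of the node is `sigP`.** [this work] -/
theorem sigAdd_nodeList (a : ℕ) (S : Finset (Pd 4)) : sigAdd 0 a (nodeList S) = sigP a S := by
  rw [sigAdd_eq, zero_add, ← List.sum_toFinset _ (nodeList_nodup S), nodeList_toFinset]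
  unfold codes sigP
  rw [Finset.sum_image fun p _ q _ e => enc_injective e]

/-! ### The colouring code of the pair -/

/-- The colouring code of a node `l` for the class predicate `P`: bit `j` iff `P (l[j+1])`. [this work] -/
def colourCode (l : List ℕ) (P : ℕ → Bool) : ℕ :=
  foldBelow (l.length - 1) (fun j acc => if P (l.getD (j + 1) 0) then acc ||| 2 ^ j else acc) 0

/-- Bits of the colouring code. [this work] -/
theorem testBit_colourCode (l : List ℕ) (P : ℕ → Bool) (j : ℕ) :
    (colourCode l P).testBit j = (decide (j < l.length - 1) && P (l.getD (j + 1) 0)) :=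
  testBit_foldBelow_mask _ _ _

/-- The colouring code is `< 2^(n-1)`. [this work] -/
theorem colourCode_lt (l : List ℕ) (P : ℕ → Bool) : colourCode l P < 2 ^ (l.length - 1) :=
  Nat.lt_pow_two_of_testBit _ fun i hi => by rw [testBit_colourCode]; simp [Nat.not_lt_of_le hi]

/-- The classes of the colouring code are given by `P` (when the lowest code is in the first class). [this work] -/
theorem cls_colourCode {l : List ℕ} {P : ℕ → Bool} (h0 : P (l.getD 0 0) = true) {i : ℕ} (hi : i < l.length) :
    cls (colourCode l P) i = P (l.getD i 0) := by
  unfold cls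
  by_cases hi0 : i = 0
  · subst hi0; rw [h0]; simp
  · rw [testBit_colourCode]
    have e : i - 1 + 1 = i := by omega
    have hlt : i - 1 < l.length - 1 := by omega
    rw [e]; simp [hi0, hlt]

/-! ### The pushed masks represent `A` and `B` -/

/-- Reading the node as an array. [this work] -/
theorem getD_nodeList_toArray (S : Finset (Pd 4)) (i : ℕ) : (nodeList S).toArray.getD i 0 = (nodeList S).getD i 0 := by
  simp only [Array.getD_eq_getD_getElem?, List.getElem?_toArray, List.getD_eq_getElem?_getD]

/-- Indices of a list versus its members. [this work] -/
theorem exists_index_iff (l : List ℕ) (Q : ℕ → Prop) : (∃ i ∈ List.range l.length, Q (l.getD i 0)) ↔ ∃ k ∈ l, Q k := by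
  constructor
  · rintro ⟨i, hi, hq⟩
    rw [List.mem_range] at hi
    exact ⟨l.getD i 0, by rw [List.getD_eq_getElem _ _ hi]; exact List.getElem_mem hi, hq⟩
  · rintro ⟨k, hk, hq⟩
    obtain ⟨i, hi, rfl⟩ := List.getElem_of_mem hk
    exact ⟨i, List.mem_range.2 hi, by rw [List.getD_eq_getElem _ _ hi]; exact hq⟩

/-- The first-class predicate on codes: being the code of a co-generator of `A`. [this work] -/
noncomputable def clsA (A : Finset (Pd 4)) (k : ℕ) : Bool := decide (k ∈ codes (coGen A))

/-- Unfolding `clsA`. [this work] -/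
theorem clsA_eq_true {A : Finset (Pd 4)} {k : ℕ} : clsA A k = true ↔ k ∈ codes (coGen A) := by
  unfold clsA; rw [decide_eq_true_eq]

/-! ### Counting and the chain bound -/

/-- Counting list entries by index. [this work] -/
theorem length_filter_range_getD (P : ℕ → Bool) : ∀ l : List ℕ,
    ((List.range l.length).filter fun j => P (l[j]?.getD 0)).length = (l.filter P).length
  | [] => by simp
  | x :: l => by
    have ih := length_filter_range_getD P l
    rw [List.length_cons, List.range_succ_eq_map, List.filter_cons, List.filter_map, List.filter_cons]
    simp only [List.getElem?_cons_zero, Option.getD_some, Function.comp_def, List.getElem?_cons_succ]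
    cases P x <;> simp [ih]

/-- The free points carry a set bit of `free = compl81 (orTab cmpT node)`. [this work] -/
theorem testBit_free {A B : Finset (Pd 4)} {q : Pd 4} (hq : Free (coGen A ∪ coGen B) q) :
    (compl81 (orTab cmpT (nodeList (coGen A ∪ coGen B)).toArray)).testBit (enc q) = true := by
  rw [testBit_compl81, testBit_orTab]
  simp only [enc_lt, decide_true, Bool.true_and, Bool.not_eq_true']
  rw [List.any_eq_false]
  intro x hx
  obtain ⟨z, hz, rfl⟩ := mem_codes.1 (mem_nodeList.1 hx)
  obtain ⟨h1, h2⟩ := hq z hz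
  rw [testBit_cmpT (enc_lt z), (leC_enc_eq_false z q).2 h2, (leC_enc_eq_false q z).2 h1]
  simp

/-- **The class-size bound**: a free antichain has at most `chainCount free` points (pigeonhole over the chains). [this work] -/
theorem card_le_chainCount {A B : Finset (Pd 4)} {Q : Finset (Pd 4)} (hQ : ∀ q ∈ Q, Free (coGen A ∪ coGen B) q)
    (hanti : IsAntichain (· ≤ ·) (Q : Set (Pd 4))) :
    Q.card ≤ chainCount (compl81 (orTab cmpT (nodeList (coGen A ∪ coGen B)).toArray)) := by
  rw [chainCount_eq, ← List.toFinset_card_of_nodup ((List.nodup_range).filter _)]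
  refine Finset.card_le_card_of_injOn (fun q => chainIdT.getD (enc q) 0) (fun q hq => ?_) (fun q₁ hq₁ q₂ hq₂ heq => ?_)
  · rw [Finset.mem_coe] at hq
    rw [Finset.mem_coe, List.mem_toFinset, List.mem_filter, List.mem_range, List.any_eq_true]
    refine ⟨chainIdT_lt _ (enc_lt q), enc q, List.mem_range.2 (enc_lt q), ?_⟩
    rw [Bool.and_eq_true, testBit_free (hQ q hq)]
    exact ⟨rfl, decide_eq_true rfl⟩
  · rw [Finset.mem_coe] at hq₁ hq₂
    have hc := chain_cmp (enc q₁) (enc_lt q₁) (enc q₂) (enc_lt q₂) heq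
    rw [Bool.or_eq_true, leC_enc, leC_enc] at hc
    rcases hc with hc | hc
    · exact hanti.eq hq₁ hq₂ hc
    · exact (hanti.eq hq₂ hq₁ hc).symm

end Summit.CriticalPhenomena.PercolationContinuityZ3.Theorems.SahiGridPattern.Pair43
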